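import Summits.QuantumFields.YangMills.Theorems.BalabanUVNodesN15CurvedGluingCubeDressedGeneralRemainderRowAdjoint
import Summits.QuantumFields.YangMills.Theorems.BalabanUVNodesN15CurvedGluingCubeDressedGeneralDefect
import Summits.QuantumFields.YangMills.Theorems.BalabanUVNodesN15TwoSpacingGluingCovariantAdjoint
import HarnessLib

/-!
# Route «BalabanUVNodes» (cluster K4 «SpineRates»), Track-A DAG node N15 = NE2, BACKGROUND LAYER — THE η-DEFECT OF THE ADJOINT REMAINDER ROW, PIECES: the generic two-grid defect of FILE 49's
# adjoint Leibniz row `G∘[Σ_μ∇*_μ∇_μ + W, M_h]` (the flat twin FILE 53 has only for the covariant `Δ_R`), and its instantiation at dag-n15-w3's GENERAL dressed cube pair, two-sided — the flat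
# half of FILE 58's `hDKL`; the assembly with the nonlocal summand and the dressed perturbation's adjoint half is the sequel `…RemainderRowAdjointDefectAssembly`

Cell `pub-ymgap`, seat `pub-ymgap-dag-n15-w5` (WIDTH SEAT w5 on node N15, director-ym R399 (3a) ∕ HUMAN RULING D-0149; sequel (g′) of this seat's (g), announced in CONDITIONAL CLAIM-2 I.31237 —
the adjoint twin of dag-n15-w4's `…RemainderRowDefect`).  `bears_on: R4∕N15 · K3⁷ SpineGivenEndpointR13SepCoPH (stmt-QuantumFields-20544)`.  Filed `--kind proof --supports
stmt-QuantumFields-20544 --as helper` — COUNT-NEUTRAL.  Theorems only; 0 `def`, 0 `sorry`.  Imports BY NAME this seat's `…RemainderRowAdjoint` (through it dag-n15-w3 g4 `…RightEntries`: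
`hasMaj_dressedV_comp_fgrad_loc₂`∕`…_bgrad_loc₂`, `hasMaj_idef_dressedV_comp_fgrad_loc₂`∕`…_bgrad_loc₂`; file 23 `hasMaj_dressedV_loc₂`; dag-n15-c FILE 49 `comp_commOp_lapOp`, `abs_comp_le`),
file 24 `…CubeDressedGeneralDefect` (`hasMaj_idef_dressedV_loc₂`), dag-n15-c FILE 53 `…TwoSpacingGluingCovariantAdjoint` (`hasMaj_idef_comp_mulOp_loc`); lit `T4EtaRateDefect` (`idef_add`,
`idef_sub`), FILE 45 (`idef_fsum`); nothing in the tree is modified, nothing re-declared.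

WHY.  FILE 58 `gluedLetters_of_cubeRows_in` consumes the η-defect of the adjoint remainder row, `hDKL : 𝔇(G′_i∘[Δ′, M_{h′_i}], G_i∘[Δ, M_{h_i}]) ≤ 1_{S_i}(y)·r₀e^{−δd}`.  For the general dressed cube
the row is `X∘[Σ∇*∇ + W, M_h] + X∘[N, M_h] − X∘[𝒱, M_h]` (`…RemainderRowAdjoint`); the defects of the last two summands are this seat's `…CommutatorAdjoint` (`hasMaj_idef_comp_commOp_of_add`,
`hasMaj_idef_comp_commOp_speciesOpM_add`).  The FLAT summand's defect needs the two-grid twin of FILE 49 §3: by FILE 49 `comp_commOp_lapOp` at both grids the row is, per direction, five terms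
`T∘M_a` with `T ∈ {G, G∘∇_μ, G∘∇⁻_μ}` and `a` a first or second difference of `h` (three of them read through a unit shift), plus `G∘[W, M_h]`; each term's defect is FILE 53's
`𝔇(T′∘M_{a′}, T∘M_a) = T′∘𝔇(M_{a′}, M_a) + 𝔇(T′, T)∘M_a ≤ 1_S1_S·(βo + mc)e^{−δd}` ([B9] Thm 3.14's difference template) — §1, generic on any carrier.  §2 reads it at the dressed cube pair:
fine two-sided entry 0 (file 23) and right entries (dag-n15-w3 g4), their two-sided defects (file 24, dag-n15-w3 g4), from the flat cubes' data at both grids.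
* §1 ★★ `hasMaj_idef_comp_commOp_lapOp` (generic): `𝔇(G′∘[Σ∇′*∇′ + W′, M_{h′}], G∘[Σ∇*∇ + W, M_h]) ≤ 1_S1_S·(|J|(3(βo₂ + m₀c₂) + 2(β₁o₁ + m₁c₁)) + r_W)·e^{−δd}` from the FINE right entries
  `G′ ≤ 1_S1_S·βe^{−δd}`, `G′∘∇′^±_μ ≤ 1_S1_S·β₁e^{−δd}`, the defects `𝔇(G′, G) ≤ 1_S1_S·m₀e^{−δd}`, `𝔇(G′∘∇′^±, G∘∇^±) ≤ 1_S1_S·m₁e^{−δd}`, COARSE partition letters `c₁, c₂`, the (translated)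
  fits `o₁, o₂` of the five coefficient families, and the `W`-row's defect `r_W`;
* §2 ★★ `hasMaj_idef_comp_commOp_lapOp_dressedV_loc₂` — THE FLAT HALF OF `hDKL` FOR THE DRESSED CUBE, two-sided, from both grids' flat-cube data (entries, right entries, their defects, cut-offs
  with one-step margins), the perturbations' letters `R` and fit `o`, `βRc_r² < 1`.

HONEST FRAMING ∕ LIMITS.  Finite-dimensional operator algebra + block-majorant bookkeeping over DISPLAYED letters; [B6] (2.91)–(2.92) p. 239 ∕ (2.133)–(2.134) p. 247, [B5] p. 39 (adjoint
representation), [B9] (3.62)–(3.65) pp. 402–403 ∕ Thm 3.14 pp. 426–427 (difference template) = SHAPES ∕ MECHANISM — nothing of [B5]∕[B6]∕[B9] asserted.  NE2⁺ NOT PRINTED, NOT proved; N15 NOT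
discharged; counts of record UNMOVED (typed 28∕28 · discharged 5∕27); no summit statement is proved here; one finite 𝕋⁴ at fixed ε — NOT infinite volume, NOT OS on ℝ⁴, NOT a mass gap, NOT Clay;
R4 closes the conditional finite-𝕋⁴ rung `BalabanLadder.UV` only.  Restate-immune (no Theses import).
-/

set_option autoImplicit false

noncomputable section
open scoped BigOperators
open Finset

namespace Summit.QuantumFields.YangMills.BalabanUVNodes.N15.CurvedSpecies

open Literature.MathematicalPhysics.QuantumFieldTheory.Balaban1983to89
open Literature.MathematicalPhysics.QuantumFieldTheory.Balaban1983to89.B11SectG (BlockNorm HasMaj RowSum)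
open Literature.MathematicalPhysics.QuantumFieldTheory.Balaban1983to89.B6RandomWalk (Triangle254)
open Literature.MathematicalPhysics.QuantumFieldTheory.Balaban1983to89.T4EtaRateDefect (idef idef_add idef_sub)
open Literature.MathematicalPhysics.QuantumFieldTheory.Balaban1983to89.T4EtaRateCoeffDefect (pull)
open Literature.MathematicalPhysics.QuantumFieldTheory.Balaban1983to89.B6Prop26Gluing (mulOp mulOp_apply ind ind_nonneg)
open Summit.QuantumFields.YangMills.BalabanUVNodes.N15.MatrixSpecies (liftBlk liftMap liftEquiv liftEquiv_apply liftEquiv_symm_apply)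
open Summit.QuantumFields.YangMills.BalabanUVNodes.N15.BackgroundLayer (fgrad bgrad fgradAdj fgrad_apply bgrad_apply fgradAdj_apply stack projO blkPair liftPair bgPropV)
open Summit.QuantumFields.YangMills.BalabanUVNodes.N15.Gluing (commOp lapOp comp_commOp_lapOp abs_comp_le hasMaj_idef_comp_mulOp_loc hasMaj_fsum idef_fsum)

/-! ## §1 The η-defect of FILE 49's adjoint Leibniz row, generic -/

section Generic

variable {Y Y' J : Type} [Fintype Y] [Fintype Y'] [Fintype J] {g : B6.Geometry} (blk : Y → g.Site) (ϖ : Y' → Y)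

/-- ★★ **THE η-DEFECT OF THE ADJOINT (2.134) LETTER, Laplacian-type `Δ_a = Σ_μ∇*_μ∇_μ + W`** (two-grid twin of dag-n15-c FILE 49 `hasMaj_comp_commOp_lapOp`; FILE 53 `hasMaj_idef_comp_commOp_covLapM`
is the covariant one).  Data at two spacings (coarse unprimed on `Y`, fine primed on `Y′`, `ϖ : Y′ → Y`): FINE right entries `G′ ≤ 1_S1_S·βe^{−δd}`, `G′∘∇′_μ, G′∘∇′⁻_μ ≤ 1_S1_S·β₁e^{−δd}`;
defects `𝔇(G′, G) ≤ 1_S1_S·m₀e^{−δd}`, `𝔇(G′∘∇′^±_μ, G∘∇^±_μ) ≤ 1_S1_S·m₁e^{−δd}`; COARSE partition letters `|∇^±_μh| ≤ c₁`, `|∇*∇h|, |∇∇h|, |∇⁻((∇⁻h)∘e)| ≤ c₂`; fits along `ϖ` of the five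
coefficient families of FILE 49 `comp_commOp_lapOp` — `∇*∇h` and `∇⁻((∇⁻h)∘e)` (`≤ o₂`), the shifted `(∇h)∘e⁻¹`, `(∇⁻h)∘e` (`≤ o₁`) and `(∇∇h)∘e⁻¹` (`≤ o₂`); the `W`-row's defect `r_W`.  Then
`𝔇(G′∘[Δ′_a, M_{h′}], G∘[Δ_a, M_h]) ≤ 1_S(y)1_S(y′)·(|J|(3(βo₂ + m₀c₂) + 2(β₁o₁ + m₁c₁)) + r_W)·e^{−δd}`.
[cite: Balaban1984PropagatorsII, (2.91)–(2.92) p.239 (mechanism, transposed), (2.133)–(2.134) p.247 (shapes); Balaban1985BackgroundPropagators, Thm 3.14 pp.426–427 (difference template)] -/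
theorem hasMaj_idef_comp_commOp_lapOp {n n' : ℝ} {e : J → Y ≃ Y} {e' : J → Y' ≃ Y'} {W G : (Y → ℝ) →ₗ[ℝ] (Y → ℝ)} {W' G' : (Y' → ℝ) →ₗ[ℝ] (Y' → ℝ)} {h : Y → ℝ} {h' : Y' → ℝ}
    {S : Set g.Site} {β β₁ c₁ c₂ o₁ o₂ m₀ m₁ rW δ : ℝ} (hβ : 0 ≤ β) (hβ₁ : 0 ≤ β₁) (hm₀ : 0 ≤ m₀) (hm₁ : 0 ≤ m₁) (hc₁ : 0 ≤ c₁) (hc₂ : 0 ≤ c₂) (ho₁ : 0 ≤ o₁) (ho₂ : 0 ≤ o₂)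
    -- coarse partition letters
    (hh1 : ∀ μ y, |fgrad n (e μ) h y| ≤ c₁) (hh1b : ∀ μ y, |bgrad n (e μ) h y| ≤ c₁) (hh2 : ∀ μ y, |fgradAdj n (e μ) (fgrad n (e μ) h) y| ≤ c₂)
    (hh2f : ∀ μ y, |fgrad n (e μ) (fgrad n (e μ) h) y| ≤ c₂) (hh2b : ∀ μ y, |bgrad n (e μ) (bgrad n (e μ) h ∘ ⇑(e μ)) y| ≤ c₂)
    -- fits along ϖ of the five coefficient families
    (hf0 : ∀ μ y', |fgradAdj n' (e' μ) (fgrad n' (e' μ) h') y' - fgradAdj n (e μ) (fgrad n (e μ) h) (ϖ y')| ≤ o₂)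
    (hf1 : ∀ μ y', |fgrad n' (e' μ) h' ((e' μ).symm y') - fgrad n (e μ) h ((e μ).symm (ϖ y'))| ≤ o₁)
    (hf2 : ∀ μ y', |fgrad n' (e' μ) (fgrad n' (e' μ) h') ((e' μ).symm y') - fgrad n (e μ) (fgrad n (e μ) h) ((e μ).symm (ϖ y'))| ≤ o₂)
    (hf3 : ∀ μ y', |bgrad n' (e' μ) h' (e' μ y') - bgrad n (e μ) h (e μ (ϖ y'))| ≤ o₁)
    (hf4 : ∀ μ y', |bgrad n' (e' μ) (bgrad n' (e' μ) h' ∘ ⇑(e' μ)) y' - bgrad n (e μ) (bgrad n (e μ) h ∘ ⇑(e μ)) (ϖ y')| ≤ o₂)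
    -- fine right entries
    (hG' : HasMaj (BlockNorm.ofBlocks g (blk ∘ ϖ)) (BlockNorm.ofBlocks g (blk ∘ ϖ)) G' (fun y y' => ind S y * ind S y' * (β * Real.exp (-(δ * g.dist y y')))))
    (hD' : ∀ μ, HasMaj (BlockNorm.ofBlocks g (blk ∘ ϖ)) (BlockNorm.ofBlocks g (blk ∘ ϖ)) (G' ∘ₗ fgrad n' (e' μ)) (fun y y' => ind S y * ind S y' * (β₁ * Real.exp (-(δ * g.dist y y')))))
    (hDb' : ∀ μ, HasMaj (BlockNorm.ofBlocks g (blk ∘ ϖ)) (BlockNorm.ofBlocks g (blk ∘ ϖ)) (G' ∘ₗ bgrad n' (e' μ)) (fun y y' => ind S y * ind S y' * (β₁ * Real.exp (-(δ * g.dist y y')))))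
    -- right-entry defects
    (hDG : HasMaj (BlockNorm.ofBlocks g blk) (BlockNorm.ofBlocks g (blk ∘ ϖ)) (idef (pull ϖ) (pull ϖ) G' G) (fun y y' => ind S y * ind S y' * (m₀ * Real.exp (-(δ * g.dist y y')))))
    (hDD : ∀ μ, HasMaj (BlockNorm.ofBlocks g blk) (BlockNorm.ofBlocks g (blk ∘ ϖ)) (idef (pull ϖ) (pull ϖ) (G' ∘ₗ fgrad n' (e' μ)) (G ∘ₗ fgrad n (e μ)))
      (fun y y' => ind S y * ind S y' * (m₁ * Real.exp (-(δ * g.dist y y')))))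
    (hDDb : ∀ μ, HasMaj (BlockNorm.ofBlocks g blk) (BlockNorm.ofBlocks g (blk ∘ ϖ)) (idef (pull ϖ) (pull ϖ) (G' ∘ₗ bgrad n' (e' μ)) (G ∘ₗ bgrad n (e μ)))
      (fun y y' => ind S y * ind S y' * (m₁ * Real.exp (-(δ * g.dist y y')))))
    -- the `W`-row's defect
    (hDW : HasMaj (BlockNorm.ofBlocks g blk) (BlockNorm.ofBlocks g (blk ∘ ϖ)) (idef (pull ϖ) (pull ϖ) (G' ∘ₗ commOp W' h') (G ∘ₗ commOp W h))
      (fun y y' => ind S y * ind S y' * (rW * Real.exp (-(δ * g.dist y y'))))) :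
    HasMaj (BlockNorm.ofBlocks g blk) (BlockNorm.ofBlocks g (blk ∘ ϖ)) (idef (pull ϖ) (pull ϖ) (G' ∘ₗ commOp (lapOp n' e' W') h') (G ∘ₗ commOp (lapOp n e W) h))
      (fun y y' => ind S y * ind S y' * ((Fintype.card J * (3 * (β * o₂ + m₀ * c₂) + 2 * (β₁ * o₁ + m₁ * c₁)) + rW) * Real.exp (-(δ * g.dist y y')))) := by
  have hterm : ∀ μ, HasMaj (BlockNorm.ofBlocks g blk) (BlockNorm.ofBlocks g (blk ∘ ϖ))
      (idef (pull ϖ) (pull ϖ)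
        (G' ∘ₗ mulOp (fgradAdj n' (e' μ) (fgrad n' (e' μ) h')) -
          ((G' ∘ₗ fgrad n' (e' μ)) ∘ₗ mulOp (fgrad n' (e' μ) h' ∘ ⇑(e' μ).symm) - G' ∘ₗ mulOp (fgrad n' (e' μ) (fgrad n' (e' μ) h') ∘ ⇑(e' μ).symm)) -
          ((G' ∘ₗ bgrad n' (e' μ)) ∘ₗ mulOp (bgrad n' (e' μ) h' ∘ ⇑(e' μ)) - G' ∘ₗ mulOp (bgrad n' (e' μ) (bgrad n' (e' μ) h' ∘ ⇑(e' μ)))))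
        (G ∘ₗ mulOp (fgradAdj n (e μ) (fgrad n (e μ) h)) -
          ((G ∘ₗ fgrad n (e μ)) ∘ₗ mulOp (fgrad n (e μ) h ∘ ⇑(e μ).symm) - G ∘ₗ mulOp (fgrad n (e μ) (fgrad n (e μ) h) ∘ ⇑(e μ).symm)) -
          ((G ∘ₗ bgrad n (e μ)) ∘ₗ mulOp (bgrad n (e μ) h ∘ ⇑(e μ)) - G ∘ₗ mulOp (bgrad n (e μ) (bgrad n (e μ) h ∘ ⇑(e μ))))))
      (fun y y' => ind S y * ind S y' * ((3 * (β * o₂ + m₀ * c₂) + 2 * (β₁ * o₁ + m₁ * c₁)) * Real.exp (-(δ * g.dist y y')))) := fun μ => by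
    have t0 := hasMaj_idef_comp_mulOp_loc blk ϖ (a := fgradAdj n (e μ) (fgrad n (e μ) h)) (a' := fgradAdj n' (e' μ) (fgrad n' (e' μ) h')) hβ hm₀ hc₂ ho₂ (hh2 μ) (hf0 μ) hG' hDG
    have t1 := hasMaj_idef_comp_mulOp_loc blk ϖ (a := fgrad n (e μ) h ∘ ⇑(e μ).symm) (a' := fgrad n' (e' μ) h' ∘ ⇑(e' μ).symm) hβ₁ hm₁ hc₁ ho₁
      (abs_comp_le (⇑(e μ).symm) (hh1 μ)) (hf1 μ) (hD' μ) (hDD μ)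
    have t2 := hasMaj_idef_comp_mulOp_loc blk ϖ (a := fgrad n (e μ) (fgrad n (e μ) h) ∘ ⇑(e μ).symm) (a' := fgrad n' (e' μ) (fgrad n' (e' μ) h') ∘ ⇑(e' μ).symm) hβ hm₀ hc₂ ho₂
      (abs_comp_le (⇑(e μ).symm) (hh2f μ)) (hf2 μ) hG' hDG
    have t3 := hasMaj_idef_comp_mulOp_loc blk ϖ (a := bgrad n (e μ) h ∘ ⇑(e μ)) (a' := bgrad n' (e' μ) h' ∘ ⇑(e' μ)) hβ₁ hm₁ hc₁ ho₁ (abs_comp_le (⇑(e μ)) (hh1b μ)) (hf3 μ)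
      (hDb' μ) (hDDb μ)
    have t4 := hasMaj_idef_comp_mulOp_loc blk ϖ (a := bgrad n (e μ) (bgrad n (e μ) h ∘ ⇑(e μ))) (a' := bgrad n' (e' μ) (bgrad n' (e' μ) h' ∘ ⇑(e' μ))) hβ hm₀ hc₂ ho₂ (hh2b μ)
      (hf4 μ) hG' hDG
    rw [idef_sub, idef_sub, idef_sub, idef_sub]
    refine ((t0.sub (t1.sub t2)).sub (t3.sub t4)).mono fun y y' => le_of_eq ?_
    ring
  have hsum := hasMaj_fsum (b₁ := BlockNorm.ofBlocks g blk) (b₃ := BlockNorm.ofBlocks g (blk ∘ ϖ)) Finset.univ _ _ fun μ _ => hterm μ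
  rw [comp_commOp_lapOp, comp_commOp_lapOp, idef_add, idef_fsum]
  refine (hsum.add hDW).mono fun y y' => le_of_eq ?_
  simp only [Finset.sum_const, Finset.card_univ, nsmul_eq_mul]
  ring

end Generic

/-! ## §2 The flat half of `hDKL` for the general dressed cube, two-sided -/

section Dressed

variable {X X' ι J : Type} [Fintype X] [Fintype X'] [DecidableEq X] [DecidableEq X'] [Fintype ι] [DecidableEq ι] [Fintype J] [DecidableEq J] {g : B6.Geometry}
  (blk : X → g.Site) (π : X' → X) (τ : J → X ≃ X) (τ' : J → X' ≃ X') (n n' : ℝ) {σ cr : ℝ} {G₀ : (X × ι → ℝ) →ₗ[ℝ] (X × ι → ℝ)}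
  {D Dq : J ⊕ J → (X × ι → ℝ) →ₗ[ℝ] (X × ι → ℝ)} {V : ((X × ι) × Option (J ⊕ J) → ℝ) →ₗ[ℝ] (X × ι → ℝ)} {G₀' : (X' × ι → ℝ) →ₗ[ℝ] (X' × ι → ℝ)}
  {D' Dq' : J ⊕ J → (X' × ι → ℝ) →ₗ[ℝ] (X' × ι → ℝ)} {V' : ((X' × ι) × Option (J ⊕ J) → ℝ) →ₗ[ℝ] (X' × ι → ℝ)}

/-- ★★ **THE FLAT HALF OF THE ADJOINT REMAINDER ROW's η-DEFECT, TWO-SIDED, GENERAL DRESSED CUBE** (§1 at `G := pr₀X̂`, `G′ := pr₀X̂′`): both grids' flat cubes `G₀, D_j, G₀′, D′_j ≤ βe^{−δd}` with right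
entries `G₀∇^±_μ, D_j∇^±_μ, G₀′∇′^±_μ, D′_j∇′^±_μ ≤ β₂e^{−δd}`, their defects `𝔇(G₀′, G₀), 𝔇(D′_j, D_j) ≤ m_Ge^{−δd}`, `𝔇(G₀′∇′^±, G₀∇^±), 𝔇(D′_j∇′^±, D_j∇^±) ≤ m_Qe^{−δd}`, cut-offs
`M_χG₀ = G₀ = G₀M_ψ` at both grids over `S` with the one-step margins `ψ₂`, `D = Dq∘G₀`, `D′ = Dq′∘G₀′`, perturbations `V̂, V̂′ ≤ Re^{−δ_Vd}` with fit `𝔇(V̂′, V̂) ≤ oe^{−δ_Vd}`, `βRc_r² < 1`;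
partition letters `c₁, c₂` (coarse, on the vector carrier), fits `o₁, o₂` along `π` (§1's five families), and the `W`-row's defect `𝔇(X′∘[W′, M_{h′}], X∘[W, M_h]) ≤ 1_S1_S·r_We^{−ρ₂d}`.  Then
`𝔇(X′∘[Σ∇′*∇′ + W′, M_{h′}], X∘[Σ∇*∇ + W, M_h]) ≤ 1_S(y)1_S(y′)·(|J|(3(β′o₂ + M₀c₂) + 2(β′₂o₁ + M₁c₁)) + r_W)·e^{−ρ₂d}` with `β′ = β(1 − βRc_r²)⁻¹`, `β′₂ = β₂(1 − βRc_r²)⁻¹` and file 24's ∕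
dag-n15-w3 g4's defect constants `M₀ = (m_Gc_r + m_Gc_r·Rβ′c_r + βoc_r·β′c_r)(1 − βRc_r²)⁻¹`, `M₁ = (m_Qc_r + m_Gc_r·Rβ′₂c_r + βoc_r·β′₂c_r)(1 − βRc_r²)⁻¹`.
[cite: Balaban1984PropagatorsII, (2.91)–(2.92) p.239, (2.133)–(2.134) p.247 (shapes + mechanism, transposed); Balaban1985BackgroundPropagators, (3.62)–(3.65) pp.402–403, Thm 3.14 pp.426–427 (template)] -/
theorem hasMaj_idef_comp_commOp_lapOp_dressedV_loc₂ (htri : Triangle254 g) (hd : ∀ a b : g.Site, 0 ≤ g.dist a b) (hrow : RowSum g σ cr) (hσ : 0 ≤ σ) (hcr : 0 ≤ cr)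
    {ρ₁ ρ₂ δ δV β β₂ R o mG mQ c₁ c₂ o₁ o₂ rW : ℝ} (hβ : 0 ≤ β) (hβ₂ : 0 ≤ β₂) (hR : 0 ≤ R) (ho : 0 ≤ o) (hmG : 0 ≤ mG) (hmQ : 0 ≤ mQ) (hσρ : σ ≤ ρ₁) (hρ₁V : ρ₁ ≤ δV)
    (hρ₁G : ρ₁ + σ ≤ δ) (hρ₂ : 0 ≤ ρ₂) (hρ₂₁ : ρ₂ + σ ≤ ρ₁) (hc₁ : 0 ≤ c₁) (hc₂ : 0 ≤ c₂) (ho₁ : 0 ≤ o₁) (ho₂ : 0 ≤ o₂)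
    (hDq : ∀ j, D j = Dq j ∘ₗ G₀) (hDq' : ∀ j, D' j = Dq' j ∘ₗ G₀')
    {S : Set g.Site} {χX ψX ψ₂X : X → ℝ} {χX' ψX' ψ₂X' : X' → ℝ}
    (hSχ : ∀ x, χX x ≠ 0 → blk x ∈ S) (hSψ : ∀ x, ψX x ≠ 0 → blk x ∈ S) (hSψ₂ : ∀ x, ψ₂X x ≠ 0 → blk x ∈ S)
    (hSχ' : ∀ x', χX' x' ≠ 0 → blk (π x') ∈ S) (hSψ' : ∀ x', ψX' x' ≠ 0 → blk (π x') ∈ S) (hSψ₂' : ∀ x', ψ₂X' x' ≠ 0 → blk (π x') ∈ S)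
    (hmf : ∀ μ x, ψX x ≠ 0 → ψ₂X x = 1 ∧ ψ₂X (τ μ x) = 1) (hmb : ∀ μ x, ψX x ≠ 0 → ψ₂X x = 1 ∧ ψ₂X ((τ μ).symm x) = 1)
    (hmf' : ∀ μ x', ψX' x' ≠ 0 → ψ₂X' x' = 1 ∧ ψ₂X' (τ' μ x') = 1) (hmb' : ∀ μ x', ψX' x' ≠ 0 → ψ₂X' x' = 1 ∧ ψ₂X' ((τ' μ).symm x') = 1)
    (hGχ : mulOp (fun p : X × ι => χX p.1) ∘ₗ G₀ = G₀) (hGψ : G₀ ∘ₗ mulOp (fun p : X × ι => ψX p.1) = G₀)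
    (hGχ' : mulOp (fun p : X' × ι => χX' p.1) ∘ₗ G₀' = G₀') (hGψ' : G₀' ∘ₗ mulOp (fun p : X' × ι => ψX' p.1) = G₀')
    {W : (X × ι → ℝ) →ₗ[ℝ] (X × ι → ℝ)} {W' : (X' × ι → ℝ) →ₗ[ℝ] (X' × ι → ℝ)} {h : X × ι → ℝ} {h' : X' × ι → ℝ}
    -- coarse partition letters, fits along π
    (hh1 : ∀ μ p, |fgrad n (liftEquiv (τ μ) ι) h p| ≤ c₁) (hh1b : ∀ μ p, |bgrad n (liftEquiv (τ μ) ι) h p| ≤ c₁)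
    (hh2 : ∀ μ p, |fgradAdj n (liftEquiv (τ μ) ι) (fgrad n (liftEquiv (τ μ) ι) h) p| ≤ c₂) (hh2f : ∀ μ p, |fgrad n (liftEquiv (τ μ) ι) (fgrad n (liftEquiv (τ μ) ι) h) p| ≤ c₂)
    (hh2b : ∀ μ p, |bgrad n (liftEquiv (τ μ) ι) (bgrad n (liftEquiv (τ μ) ι) h ∘ ⇑(liftEquiv (τ μ) ι)) p| ≤ c₂)
    (hf0 : ∀ μ p', |fgradAdj n' (liftEquiv (τ' μ) ι) (fgrad n' (liftEquiv (τ' μ) ι) h') p' - fgradAdj n (liftEquiv (τ μ) ι) (fgrad n (liftEquiv (τ μ) ι) h) (liftMap π ι p')| ≤ o₂)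
    (hf1 : ∀ μ p', |fgrad n' (liftEquiv (τ' μ) ι) h' ((liftEquiv (τ' μ) ι).symm p') - fgrad n (liftEquiv (τ μ) ι) h ((liftEquiv (τ μ) ι).symm (liftMap π ι p'))| ≤ o₁)
    (hf2 : ∀ μ p', |fgrad n' (liftEquiv (τ' μ) ι) (fgrad n' (liftEquiv (τ' μ) ι) h') ((liftEquiv (τ' μ) ι).symm p') -
      fgrad n (liftEquiv (τ μ) ι) (fgrad n (liftEquiv (τ μ) ι) h) ((liftEquiv (τ μ) ι).symm (liftMap π ι p'))| ≤ o₂)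
    (hf3 : ∀ μ p', |bgrad n' (liftEquiv (τ' μ) ι) h' (liftEquiv (τ' μ) ι p') - bgrad n (liftEquiv (τ μ) ι) h (liftEquiv (τ μ) ι (liftMap π ι p'))| ≤ o₁)
    (hf4 : ∀ μ p', |bgrad n' (liftEquiv (τ' μ) ι) (bgrad n' (liftEquiv (τ' μ) ι) h' ∘ ⇑(liftEquiv (τ' μ) ι)) p' -
      bgrad n (liftEquiv (τ μ) ι) (bgrad n (liftEquiv (τ μ) ι) h ∘ ⇑(liftEquiv (τ μ) ι)) (liftMap π ι p')| ≤ o₂)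
    -- both grids' flat cubes, right entries, defects
    (hG : HasMaj (BlockNorm.ofBlocks g (liftBlk blk ι)) (BlockNorm.ofBlocks g (liftBlk blk ι)) G₀ (fun y y' => β * Real.exp (-(δ * g.dist y y'))))
    (hD : ∀ j, HasMaj (BlockNorm.ofBlocks g (liftBlk blk ι)) (BlockNorm.ofBlocks g (liftBlk blk ι)) (D j) (fun y y' => β * Real.exp (-(δ * g.dist y y'))))
    (hG' : HasMaj (BlockNorm.ofBlocks g (liftBlk (blk ∘ π) ι)) (BlockNorm.ofBlocks g (liftBlk (blk ∘ π) ι)) G₀' (fun y y' => β * Real.exp (-(δ * g.dist y y'))))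
    (hD' : ∀ j, HasMaj (BlockNorm.ofBlocks g (liftBlk (blk ∘ π) ι)) (BlockNorm.ofBlocks g (liftBlk (blk ∘ π) ι)) (D' j) (fun y y' => β * Real.exp (-(δ * g.dist y y'))))
    (hDG : HasMaj (BlockNorm.ofBlocks g (liftBlk blk ι)) (BlockNorm.ofBlocks g (liftBlk (blk ∘ π) ι)) (idef (pull (liftMap π ι)) (pull (liftMap π ι)) G₀' G₀)
      (fun y y' => mG * Real.exp (-(δ * g.dist y y'))))
    (hDD : ∀ j, HasMaj (BlockNorm.ofBlocks g (liftBlk blk ι)) (BlockNorm.ofBlocks g (liftBlk (blk ∘ π) ι)) (idef (pull (liftMap π ι)) (pull (liftMap π ι)) (D' j) (D j))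
      (fun y y' => mG * Real.exp (-(δ * g.dist y y'))))
    (hGQf : ∀ μ, HasMaj (BlockNorm.ofBlocks g (liftBlk blk ι)) (BlockNorm.ofBlocks g (liftBlk blk ι)) (G₀ ∘ₗ fgrad n (liftEquiv (τ μ) ι)) (fun y y' => β₂ * Real.exp (-(δ * g.dist y y'))))
    (hDQf : ∀ μ j, HasMaj (BlockNorm.ofBlocks g (liftBlk blk ι)) (BlockNorm.ofBlocks g (liftBlk blk ι)) (D j ∘ₗ fgrad n (liftEquiv (τ μ) ι)) (fun y y' => β₂ * Real.exp (-(δ * g.dist y y'))))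
    (hGQb : ∀ μ, HasMaj (BlockNorm.ofBlocks g (liftBlk blk ι)) (BlockNorm.ofBlocks g (liftBlk blk ι)) (G₀ ∘ₗ bgrad n (liftEquiv (τ μ) ι)) (fun y y' => β₂ * Real.exp (-(δ * g.dist y y'))))
    (hDQb : ∀ μ j, HasMaj (BlockNorm.ofBlocks g (liftBlk blk ι)) (BlockNorm.ofBlocks g (liftBlk blk ι)) (D j ∘ₗ bgrad n (liftEquiv (τ μ) ι)) (fun y y' => β₂ * Real.exp (-(δ * g.dist y y'))))
    (hGQf' : ∀ μ, HasMaj (BlockNorm.ofBlocks g (liftBlk (blk ∘ π) ι)) (BlockNorm.ofBlocks g (liftBlk (blk ∘ π) ι)) (G₀' ∘ₗ fgrad n' (liftEquiv (τ' μ) ι))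
      (fun y y' => β₂ * Real.exp (-(δ * g.dist y y'))))
    (hDQf' : ∀ μ j, HasMaj (BlockNorm.ofBlocks g (liftBlk (blk ∘ π) ι)) (BlockNorm.ofBlocks g (liftBlk (blk ∘ π) ι)) (D' j ∘ₗ fgrad n' (liftEquiv (τ' μ) ι))
      (fun y y' => β₂ * Real.exp (-(δ * g.dist y y'))))
    (hGQb' : ∀ μ, HasMaj (BlockNorm.ofBlocks g (liftBlk (blk ∘ π) ι)) (BlockNorm.ofBlocks g (liftBlk (blk ∘ π) ι)) (G₀' ∘ₗ bgrad n' (liftEquiv (τ' μ) ι))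
      (fun y y' => β₂ * Real.exp (-(δ * g.dist y y'))))
    (hDQb' : ∀ μ j, HasMaj (BlockNorm.ofBlocks g (liftBlk (blk ∘ π) ι)) (BlockNorm.ofBlocks g (liftBlk (blk ∘ π) ι)) (D' j ∘ₗ bgrad n' (liftEquiv (τ' μ) ι))
      (fun y y' => β₂ * Real.exp (-(δ * g.dist y y'))))
    (hDGQf : ∀ μ, HasMaj (BlockNorm.ofBlocks g (liftBlk blk ι)) (BlockNorm.ofBlocks g (liftBlk (blk ∘ π) ι))
      (idef (pull (liftMap π ι)) (pull (liftMap π ι)) (G₀' ∘ₗ fgrad n' (liftEquiv (τ' μ) ι)) (G₀ ∘ₗ fgrad n (liftEquiv (τ μ) ι))) (fun y y' => mQ * Real.exp (-(δ * g.dist y y'))))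
    (hDDQf : ∀ μ j, HasMaj (BlockNorm.ofBlocks g (liftBlk blk ι)) (BlockNorm.ofBlocks g (liftBlk (blk ∘ π) ι))
      (idef (pull (liftMap π ι)) (pull (liftMap π ι)) (D' j ∘ₗ fgrad n' (liftEquiv (τ' μ) ι)) (D j ∘ₗ fgrad n (liftEquiv (τ μ) ι))) (fun y y' => mQ * Real.exp (-(δ * g.dist y y'))))
    (hDGQb : ∀ μ, HasMaj (BlockNorm.ofBlocks g (liftBlk blk ι)) (BlockNorm.ofBlocks g (liftBlk (blk ∘ π) ι))
      (idef (pull (liftMap π ι)) (pull (liftMap π ι)) (G₀' ∘ₗ bgrad n' (liftEquiv (τ' μ) ι)) (G₀ ∘ₗ bgrad n (liftEquiv (τ μ) ι))) (fun y y' => mQ * Real.exp (-(δ * g.dist y y'))))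
    (hDDQb : ∀ μ j, HasMaj (BlockNorm.ofBlocks g (liftBlk blk ι)) (BlockNorm.ofBlocks g (liftBlk (blk ∘ π) ι))
      (idef (pull (liftMap π ι)) (pull (liftMap π ι)) (D' j ∘ₗ bgrad n' (liftEquiv (τ' μ) ι)) (D j ∘ₗ bgrad n (liftEquiv (τ μ) ι))) (fun y y' => mQ * Real.exp (-(δ * g.dist y y'))))
    (hV : HasMaj (BlockNorm.ofBlocks g (blkPair (liftBlk blk ι))) (BlockNorm.ofBlocks g (liftBlk blk ι)) V (fun y y' => R * Real.exp (-(δV * g.dist y y'))))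
    (hV' : HasMaj (BlockNorm.ofBlocks g (blkPair (liftBlk (blk ∘ π) ι))) (BlockNorm.ofBlocks g (liftBlk (blk ∘ π) ι)) V' (fun y y' => R * Real.exp (-(δV * g.dist y y'))))
    (hDV : HasMaj (BlockNorm.ofBlocks g (blkPair (liftBlk blk ι))) (BlockNorm.ofBlocks g (liftBlk (blk ∘ π) ι))
      (idef (pull (liftPair (liftMap π ι))) (pull (liftMap π ι)) V' V) (fun y y' => o * Real.exp (-(δV * g.dist y y'))))
    (hq : β * (R * cr) * cr < 1)
    -- the `W`-row's defect at the dressed pair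
    (hDW : HasMaj (BlockNorm.ofBlocks g (liftBlk blk ι)) (BlockNorm.ofBlocks g (liftBlk (blk ∘ π) ι))
      (idef (pull (liftMap π ι)) (pull (liftMap π ι)) ((projO none ∘ₗ bgPropV (stack G₀' D') V') ∘ₗ commOp W' h') ((projO none ∘ₗ bgPropV (stack G₀ D) V) ∘ₗ commOp W h))
      (fun y y' => ind S y * ind S y' * (rW * Real.exp (-(ρ₂ * g.dist y y'))))) :
    HasMaj (BlockNorm.ofBlocks g (liftBlk blk ι)) (BlockNorm.ofBlocks g (liftBlk (blk ∘ π) ι))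
      (idef (pull (liftMap π ι)) (pull (liftMap π ι)) ((projO none ∘ₗ bgPropV (stack G₀' D') V') ∘ₗ commOp (lapOp n' (fun μ => liftEquiv (τ' μ) ι) W') h')
        ((projO none ∘ₗ bgPropV (stack G₀ D) V) ∘ₗ commOp (lapOp n (fun μ => liftEquiv (τ μ) ι) W) h))
      (fun y y' => ind S y * ind S y' * ((Fintype.card J *
          (3 * (β * (1 - β * (R * cr) * cr)⁻¹ * o₂ +
              (mG * cr + 1 * (mG * cr) * (R * (β * (1 - β * (R * cr) * cr)⁻¹) * cr) + β * o * cr * (β * (1 - β * (R * cr) * cr)⁻¹) * cr) * (1 - 1 * (β * (R * cr) * cr))⁻¹ * c₂) +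
            2 * (β₂ * (1 - β * (R * cr) * cr)⁻¹ * o₁ +
              (mQ * cr + mG * cr * (R * (β₂ * (1 - β * (R * cr) * cr)⁻¹) * cr) + β * o * cr * (β₂ * (1 - β * (R * cr) * cr)⁻¹) * cr) * (1 - β * (R * cr) * cr)⁻¹ * c₁)) + rW) *
        Real.exp (-(ρ₂ * g.dist y y')))) := by
  have hq' : 0 < 1 - β * (R * cr) * cr := by linarith
  have hB : 0 ≤ β * (1 - β * (R * cr) * cr)⁻¹ := mul_nonneg hβ (inv_nonneg.2 hq'.le)
  have hB₂ : 0 ≤ β₂ * (1 - β * (R * cr) * cr)⁻¹ := mul_nonneg hβ₂ (inv_nonneg.2 hq'.le)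
  have hM₀ : 0 ≤ (mG * cr + 1 * (mG * cr) * (R * (β * (1 - β * (R * cr) * cr)⁻¹) * cr) + β * o * cr * (β * (1 - β * (R * cr) * cr)⁻¹) * cr) * (1 - 1 * (β * (R * cr) * cr))⁻¹ := by
    have h2 : 0 ≤ (1 - 1 * (β * (R * cr) * cr))⁻¹ := inv_nonneg.2 (by linarith)
    positivity
  have hM₁ : 0 ≤ (mQ * cr + mG * cr * (R * (β₂ * (1 - β * (R * cr) * cr)⁻¹) * cr) + β * o * cr * (β₂ * (1 - β * (R * cr) * cr)⁻¹) * cr) * (1 - β * (R * cr) * cr)⁻¹ := by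
    have h2 : 0 ≤ (1 - β * (R * cr) * cr)⁻¹ := inv_nonneg.2 hq'.le
    positivity
  -- fine two-sided entry 0 (file 23) and right entries (dag-n15-w3 g4) at the fine grid
  have hE' := hasMaj_dressedV_loc₂ (blk ∘ π) htri hd hrow hσ hβ hR hcr hσρ hρ₁V hρ₁G hρ₂ hρ₂₁ hSχ' hSψ' hGχ' hGψ' hDq' hG' hD' hV' hq
  have hED' := fun μ => hasMaj_dressedV_comp_fgrad_loc₂ (blk ∘ π) τ' n' htri hd hrow hσ hβ hβ₂ hR hcr hσρ hρ₁V hρ₁G hρ₂ hρ₂₁ hDq' μ hSχ' hSψ₂' (hmf' μ) hGχ' hGψ' hG' hD' (hGQf' μ)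
    (hDQf' μ) hV' hq
  have hEDb' := fun μ => hasMaj_dressedV_comp_bgrad_loc₂ (blk ∘ π) τ' n' htri hd hrow hσ hβ hβ₂ hR hcr hσρ hρ₁V hρ₁G hρ₂ hρ₂₁ hDq' μ hSχ' hSψ₂' (hmb' μ) hGχ' hGψ' hG' hD' (hGQb' μ)
    (hDQb' μ) hV' hq
  -- two-sided defects: entry 0 (file 24), right entries (dag-n15-w3 g4)
  have hDX := hasMaj_idef_dressedV_loc₂ blk π htri hd hrow hσ hcr hβ hR ho hmG hσρ hρ₁V hρ₁G hρ₂ hρ₂₁ hDq hDq' hSχ hSψ hSχ' hSψ' hGχ hGψ hGχ' hGψ' hG hD hG' hD' hDG hDD hV hV' hDV hq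
  have hDXD := fun μ => hasMaj_idef_dressedV_comp_fgrad_loc₂ blk π τ τ' n n' htri hd hrow hσ hcr hβ hβ₂ hR ho hmG hmQ hσρ hρ₁V hρ₁G hρ₂ hρ₂₁ hDq hDq' μ hSχ hSψ₂ hSχ' hSψ₂' (hmf μ)
    (hmf' μ) hGχ hGψ hGχ' hGψ' hG hD hG' hD' hDG hDD (hGQf μ) (hDQf μ) (hDGQf μ) (hDDQf μ) hV hV' hDV hq
  have hDXDb := fun μ => hasMaj_idef_dressedV_comp_bgrad_loc₂ blk π τ τ' n n' htri hd hrow hσ hcr hβ hβ₂ hR ho hmG hmQ hσρ hρ₁V hρ₁G hρ₂ hρ₂₁ hDq hDq' μ hSχ hSψ₂ hSχ' hSψ₂' (hmb μ)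
    (hmb' μ) hGχ hGψ hGχ' hGψ' hG hD hG' hD' hDG hDD (hGQb μ) (hDQb μ) (hDGQb μ) (hDDQb μ) hV hV' hDV hq
  exact hasMaj_idef_comp_commOp_lapOp (liftBlk blk ι) (liftMap π ι) (e := fun μ => liftEquiv (τ μ) ι) (e' := fun μ => liftEquiv (τ' μ) ι) hB hB₂ hM₀ hM₁ hc₁ hc₂ ho₁ ho₂ hh1 hh1b hh2 hh2f hh2b
    hf0 hf1 hf2 hf3 hf4 hE' hED' hEDb' hDX hDXD hDXDb hDW

end Dressed

end Summit.QuantumFields.YangMills.BalabanUVNodes.N15.CurvedSpecies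

end
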